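import Literature.Barriers.Parity.SiegelZeroQuadraticPolynomialsProp2Sums
import HarnessLib

/-!
# Granville–Mollin's Proposition 2: the estimate of `log ∏_{p ≤ X} (1 − 1/p)⁻¹(1 − ω(p)/p)` at
# level `X` and its limit form (§8)

Topic `Literature/Barriers/Parity`, companion ("Proofs"-type, theorems only, everything PROVED) of
`SiegelZeroQuadraticPolynomials.lean`, fourth layer of the proof of
`Literature.Barriers.Parity.GranvilleMollin2000_prop2` (Granville–Mollin, *Rabinowitsch revisited*,
Acta Arith. 96 (2000), Proposition 2). The §8 computation made explicit, for `d = −q`,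
`q ≡ 3 (mod 8)`, `U = q^{η/M}`, `κ = 1/(η log q) = 1 − β`:

`log ∏_{p ≤ X} (1 − 1/p)⁻¹(1 − ω(p)/p) = [log log X + γ] + log ϱ_d − ∑_{√q < p ≤ X} ω(p)/p + o(1)`
(Mertens, and `log(1 − ω/p) = −ω/p + O(1/p²)`), `∑_{U < p ≤ X} ω(p)/p = [log log X − log log U]
+ [E₁(κ log X) − E₁(1/M)] + o(1)` (Mertens and partial summation of the explicit formula (3.3)),
and `γ + log log U + E₁(1/M) = log(η log q) + Ein(1/M)` with `0 ≤ Ein(1/M) ≤ 1/M`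
(`Ein = γ + log + E₁`, `Literature/NumberTheory/Sieve/EulerMascheroniEin.lean`; `M log U = η log q`),
whence

* `abs_log_batemanHornPartial_sub_log_le` — `|log ∏_{p ≤ X}(…) − log(ϱ_d η log q)| ≤
  20/log X + 16/(⌊√q⌋+1) + ∑_{√q < p ≤ U} ω(p)/p + 8/log U + R(U, X) + E₁(κ log X) + 1/M`;
* `pos_and_abs_log_sub_log_gmRho_le` — letting `X → ∞` along the convergent partial products
  (`HasBatemanHornConst ![f_d] c`): `c > 0` and `|log c − log(ϱ_d η log q)| ≤ 16/(⌊√q⌋+1) +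
  ∑_{√q < p ≤ U} ω(p)/p + 8/log U + R_∞(U) + 1/M`.

The source takes `T = d^{ηC}`, `U = d^{η/C}` and evaluates `−∫_U^T (t − t^β)/(t² log t) dt =
−∫_{1/C}^{C} (1 − e^{−v}) dv/v → −log C − γ`; here the range `p > U` is handled in one piece by the
exponential integral (`E₁(κ log X) → 0`), which is the same computation. The assembly with the
choice of parameters is `SiegelZeroQuadraticPolynomialsProofs.lean`.

[cite: GranvilleMollin2000, Proposition 2 and §8]
-/

noncomputable section

open Finset Real

namespace Literature.Barriers.Parity

open Literature.NumberTheory.LFunctions.SiegelZero (jacobiTheta)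
open Literature.NumberTheory.Sieve (expIntegralE1 polyRootCountMod)

/-! ### The per-`X` estimate of `log ∏_{p ≤ X} (1 − 1/p)⁻¹ (1 − ω(p)/p)` (§8) -/

/-- `E₁(x) ≥ 0` for `x ≥ 0`. [folklore] -/
theorem expIntegralE1_nonneg {x : ℝ} (hx : 0 ≤ x) : 0 ≤ expIntegralE1 x :=
  _root_.MeasureTheory.setIntegral_nonneg measurableSet_Ioi fun t (ht : x < t) =>
    div_nonneg (Real.exp_pos _).le (hx.trans_lt ht).le

/-- `⌊√q⌋ ≥ 4` for `q ≥ 16`. [folklore] -/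
theorem four_le_floor_sqrt {q : ℕ} (hq : 16 ≤ q) : 4 ≤ ⌊Real.sqrt q⌋₊ := by
  refine Nat.le_floor ?_
  rw [show ((4 : ℕ) : ℝ) = Real.sqrt 16 by
    rw [show (16 : ℝ) = 4 ^ 2 by norm_num, Real.sqrt_sq (by norm_num)]; norm_num]
  exact Real.sqrt_le_sqrt (by exact_mod_cast hq)

/-- **Granville–Mollin §8, the estimate at level `X`** (everything explicit). Let `d = −q`,
`q ≡ 3 (mod 8)`, `q ≥ 16`, `η > 0` with `η log q > 1`, `M > 0`, `U = q^{η/M}` with `U ≥ e`,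
`U ≥ √q`, and let `X ≥ U` be an integer. Suppose the twisted prime sum satisfies the explicit-formula
bound `|θ(t; (·/q)) + t^β/β| ≤ A₁ t/log t + A₂ t^{1−ν}` on `[U, X]` (`β = 1 − 1/(η log q)`; this is
(3.3)). Then, with `ϱ = ϱ_d`, `ω = ω_{f_d}`, `s = ⌊√q⌋`,
`|log ∏_{p ≤ X}(1 − 1/p)⁻¹(1 − ω(p)/p) − log(ϱ · η log q)| ≤ 20/log X + 16/(s+1) + ∑_{s < p ≤ U} ω(p)/p
 + 8/log U + R(U, X) + E₁(log X/(η log q)) + 1/M`, `R` the partial-summation error of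
`abs_sum_jacobi_div_sub_expIntegralE1_le` (Mertens' theorems for `∏(1 − 1/p)⁻¹` and `∑ 1/p`, the
second-order terms `log(1 − ω/p) + ω/p`, partial summation of `∑ (p/q)/p` on `(U, X]` into
`E₁(κ log X) − E₁(1/M)`, and `γ + log(1/M)⁻¹... = Ein(1/M) − E₁(1/M)` with `0 ≤ Ein(1/M) ≤ 1/M`).
[cite: GranvilleMollin2000, §8] -/
theorem abs_log_batemanHornPartial_sub_log_le {d : ℤ} {q : ℕ} (hdq : d = -(q : ℤ)) (hq8 : q % 8 = 3)
    (hq16 : 16 ≤ q) {η M ν A₁ A₂ U : ℝ} {X : ℕ} (hM : 0 < M) (hη : 0 < η)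
    (hηq : 1 < η * Real.log q) (hU : U = (q : ℝ) ^ (η / M)) (hUe : Real.exp 1 ≤ U)
    (hsqU : Real.sqrt q ≤ U) (hUX : U ≤ (X : ℝ)) (hν : 0 < ν) (hA₁ : 0 ≤ A₁) (hA₂ : 0 ≤ A₂)
    (hθ : ∀ t ∈ Set.Icc U (X : ℝ),
      |jacobiTheta q t + t ^ (1 - 1 / (η * Real.log q)) / (1 - 1 / (η * Real.log q))| ≤
        A₁ * t / Real.log t + A₂ * t ^ (1 - ν)) :
    |Real.log (Literature.NumberTheory.Sieve.batemanHornPartial ![rabinowitschPoly d] X) -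
        Real.log (gmRho d * (η * Real.log q))| ≤
      20 / Real.log X + 16 / ((⌊Real.sqrt q⌋₊ : ℝ) + 1) +
        ∑ p ∈ (Nat.primesLE ⌊U⌋₊).filter (fun p => ⌊Real.sqrt q⌋₊ < p),
          (polyRootCountMod ![rabinowitschPoly d] p : ℝ) / p +
        8 / Real.log U +
        (A₁ / Real.log X ^ 2 + A₂ * (X : ℝ) ^ (-ν) / Real.log X +
          (A₁ / Real.log U ^ 2 + A₂ * U ^ (-ν) / Real.log U) +
          (2 * A₁ / Real.log U + 2 * A₂ * U ^ (-ν) / (ν * Real.log U))) +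
        expIntegralE1 (1 / (η * Real.log q) * Real.log X) + 1 / M := by
  -- the players and their sizes
  have hq4 : q % 4 = 3 := by omega
  set s : ℕ := ⌊Real.sqrt q⌋₊ with hs_def
  have hs4 : 4 ≤ s := four_le_floor_sqrt hq16
  have hq0 : (0 : ℝ) < q := by exact_mod_cast (show 0 < q by omega)
  have hq1 : (1 : ℝ) < q := by exact_mod_cast (show 1 < q by omega)
  have hlogq : 0 < Real.log q := Real.log_pos hq1
  have he2 : (2 : ℝ) < Real.exp 1 := lt_trans (by norm_num) Real.exp_one_gt_d9
  have hU2 : 2 ≤ U := by linarith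
  have hU1 : 1 < U := by linarith
  have hU0 : 0 < U := by linarith
  have hX2 : (2 : ℝ) ≤ X := hU2.trans hUX
  have hX1 : (1 : ℝ) < X := by linarith
  have hlogU : 0 < Real.log U := Real.log_pos hU1
  have hlogU1 : 1 ≤ Real.log U := by rwa [Real.le_log_iff_exp_le hU0]
  have hlogX : 0 < Real.log X := Real.log_pos hX1
  have hsU : s ≤ ⌊U⌋₊ := Nat.floor_le_floor hsqU
  have hUX' : ⌊U⌋₊ ≤ X := by
    have := Nat.floor_le_floor hUX
    rwa [Nat.floor_natCast] at this
  have hsX : s ≤ X := hsU.trans hUX'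
  set κ : ℝ := 1 / (η * Real.log q) with hκ_def
  have hηL : 0 < η * Real.log q := mul_pos hη hlogq
  have hκ0 : 0 < κ := one_div_pos.mpr hηL
  have hκ1 : κ < 1 := (div_lt_one hηL).mpr hηq
  -- `log U = (η/M) log q`, `κ log U = 1/M`, `η log q = M log U`
  have hlogU_eq : Real.log U = η / M * Real.log q := by rw [hU, Real.log_rpow hq0]
  have hκU : κ * Real.log U = 1 / M := by
    rw [hlogU_eq, hκ_def]; field_simp
  have hML : η * Real.log q = M * Real.log U := by
    rw [hlogU_eq]; field_simp
  -- (1) the product formula and the second-order terms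
  have hlogP := log_batemanHornPartial_rabinowitsch hdq hq8 (X := X) hsX
  have hT₂ := abs_sum_log_one_sub_omega_add_le hdq hq4 (s := s) (X := X) hs4
  set T₂ := ∑ p ∈ (Nat.primesLE X).filter (fun p => s < p),
    (Real.log (1 - (polyRootCountMod ![rabinowitschPoly d] p : ℝ) / p) +
      (polyRootCountMod ![rabinowitschPoly d] p : ℝ) / p) with hT₂_def
  set SX := ∑ p ∈ (Nat.primesLE X).filter (fun p => s < p),
    (polyRootCountMod ![rabinowitschPoly d] p : ℝ) / p with hSX_def
  have hsumlog : ∑ p ∈ (Nat.primesLE X).filter (fun p => s < p),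
      Real.log (1 - (polyRootCountMod ![rabinowitschPoly d] p : ℝ) / p) = T₂ - SX := by
    rw [hT₂_def, hSX_def, ← sum_sub_distrib]
    exact sum_congr rfl fun p _ => by ring
  -- (2) splitting `SX` at `U` and into `1 + (p/q)`
  set H := ∑ p ∈ (Nat.primesLE ⌊U⌋₊).filter (fun p => s < p),
    (polyRootCountMod ![rabinowitschPoly d] p : ℝ) / p with hH_def
  set S₁ := ∑ p ∈ (Nat.primesLE X).filter (fun p => ⌊U⌋₊ < p), (1 : ℝ) / (p : ℝ) with hS₁_def
  set Sχ := ∑ p ∈ (Nat.primesLE X).filter (fun p => ⌊U⌋₊ < p),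
    ((jacobiSym (p : ℤ) q : ℤ) : ℝ) / (p : ℝ) with hSχ_def
  have hSX : SX = H + (S₁ + Sχ) := by
    rw [hSX_def, sum_primesLE_filter_lt_split hsU hUX', sum_omega_div_eq_add hdq hq4 ⌊U⌋₊ X]
  have hH0 : 0 ≤ H := sum_omega_div_nonneg d _
  -- (3) Mertens for `∏ (1 − 1/p)⁻¹` and `∑ 1/p`
  have hM₃ := Literature.NumberTheory.LFunctions.Mertens.abs_mertensLog_sub_le hX2
  have hM₂ : |S₁ - (Real.log (Real.log X) - Real.log (Real.log U))| ≤
      8 / Real.log X + 8 / Real.log U := by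
    have h := abs_sum_inv_primes_sub_loglog_le hU2 hUX
    simpa only [Nat.floor_natCast] using h
  -- (4) partial summation of `∑ (p/q)/p`
  have hAbel : |Sχ - (expIntegralE1 (κ * Real.log X) - expIntegralE1 (κ * Real.log U))| ≤
      A₁ / Real.log X ^ 2 + A₂ * (X : ℝ) ^ (-ν) / Real.log X +
        (A₁ / Real.log U ^ 2 + A₂ * U ^ (-ν) / Real.log U) +
        (2 * A₁ / Real.log U + 2 * A₂ * U ^ (-ν) / (ν * Real.log U)) := by
    have h := abs_sum_jacobi_div_sub_expIntegralE1_le (q := q) hUe hUX hκ0 hκ1 hν hA₁ hA₂ hθ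
    simpa only [Nat.floor_natCast] using h
  -- (5) the constant: `γ + log log U + E₁(1/M) − log(η log q) = Ein(1/M) − ... `
  have hM1 : 0 < 1 / M := one_div_pos.mpr hM
  have hein := Literature.NumberTheory.Sieve.ein_eq_add hM1
  have hein0 := Literature.NumberTheory.Sieve.ein_nonneg hM1.le
  have hein1 := Literature.NumberTheory.Sieve.ein_le_self hM1.le
  have hE₁X : 0 ≤ expIntegralE1 (κ * Real.log X) :=
    expIntegralE1_nonneg (mul_nonneg hκ0.le hlogX.le)
  have hϱ : 0 < gmRho d := gmRho_pos hdq hq8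
  have hlogprod : Real.log (gmRho d * (η * Real.log q)) =
      Real.log (gmRho d) + Real.log M + Real.log (Real.log U) := by
    rw [Real.log_mul hϱ.ne' hηL.ne', hML, Real.log_mul hM.ne' hlogU.ne', add_assoc]
  have hlogM : Real.log (1 / M) = -Real.log M := by rw [one_div, Real.log_inv]
  -- (6) the identity
  have hid : Real.log (Literature.NumberTheory.Sieve.batemanHornPartial ![rabinowitschPoly d] X) -
      Real.log (gmRho d * (η * Real.log q)) =
      (Literature.NumberTheory.LFunctions.Nicolas.mertensLog X - Real.log (Real.log X) -
          Real.eulerMascheroniConstant) + T₂ - H -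
        (S₁ - (Real.log (Real.log X) - Real.log (Real.log U))) -
        (Sχ - (expIntegralE1 (κ * Real.log X) - expIntegralE1 (κ * Real.log U))) -
        expIntegralE1 (κ * Real.log X) + Literature.NumberTheory.Sieve.ein (1 / M) := by
    rw [hlogP, hsumlog, hSX, hlogprod, hein, hlogM, hκU]
    ring
  -- (7) conclusion
  rw [hid]
  have hκX : κ * Real.log X = 1 / (η * Real.log q) * Real.log X := rfl
  rw [← hκX]
  calc |(Literature.NumberTheory.LFunctions.Nicolas.mertensLog X - Real.log (Real.log X) -
            Real.eulerMascheroniConstant) + T₂ - H -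
          (S₁ - (Real.log (Real.log X) - Real.log (Real.log U))) -
          (Sχ - (expIntegralE1 (κ * Real.log X) - expIntegralE1 (κ * Real.log U))) -
          expIntegralE1 (κ * Real.log X) + Literature.NumberTheory.Sieve.ein (1 / M)|
      ≤ |Literature.NumberTheory.LFunctions.Nicolas.mertensLog X - Real.log (Real.log X) -
            Real.eulerMascheroniConstant| + |T₂| + H +
          |S₁ - (Real.log (Real.log X) - Real.log (Real.log U))| +
          |Sχ - (expIntegralE1 (κ * Real.log X) - expIntegralE1 (κ * Real.log U))| +
          expIntegralE1 (κ * Real.log X) + Literature.NumberTheory.Sieve.ein (1 / M) := by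
        have h1 : ∀ a b : ℝ, |a - b| ≤ |a| + |b| := fun a b => abs_sub a b
        have h2 : ∀ a b : ℝ, |a + b| ≤ |a| + |b| := fun a b => abs_add_le a b
        calc _ ≤ |(Literature.NumberTheory.LFunctions.Nicolas.mertensLog X - Real.log (Real.log X) -
            Real.eulerMascheroniConstant) + T₂ - H -
          (S₁ - (Real.log (Real.log X) - Real.log (Real.log U))) -
          (Sχ - (expIntegralE1 (κ * Real.log X) - expIntegralE1 (κ * Real.log U))) -
          expIntegralE1 (κ * Real.log X)| + |Literature.NumberTheory.Sieve.ein (1 / M)| := h2 _ _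
          _ ≤ _ := by
            rw [abs_of_nonneg hein0]
            gcongr
            refine (h1 _ _).trans ?_
            rw [abs_of_nonneg hE₁X]
            gcongr
            refine (h1 _ _).trans ?_
            gcongr
            refine (h1 _ _).trans ?_
            gcongr
            refine (h1 _ _).trans ?_
            rw [abs_of_nonneg hH0]
            gcongr
            exact h2 _ _
    _ ≤ 12 / Real.log X + 16 / ((s : ℝ) + 1) + H + (8 / Real.log X + 8 / Real.log U) +
          (A₁ / Real.log X ^ 2 + A₂ * (X : ℝ) ^ (-ν) / Real.log X +
            (A₁ / Real.log U ^ 2 + A₂ * U ^ (-ν) / Real.log U) +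
            (2 * A₁ / Real.log U + 2 * A₂ * U ^ (-ν) / (ν * Real.log U))) +
          expIntegralE1 (κ * Real.log X) + 1 / M := by
        gcongr
    _ = _ := by ring


/-! ### From the per-`X` estimate to the limit -/

open Filter _root_.Topology in
/-- If `P(X) → c`, `P(X) > 0` and `|log P(X) − log τ| ≤ B + r(X)` eventually with `r(X) → 0`
(`τ > 0`), then `c > 0` and `|log c − log τ| ≤ B`. [folklore] -/
theorem pos_and_abs_log_sub_le_of_tendsto {P : ℕ → ℝ} {c τ B : ℝ} {r : ℕ → ℝ} (hτ : 0 < τ)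
    (hP : Tendsto P atTop (𝓝 c)) (hr : Tendsto r atTop (𝓝 0))
    (hb : ∀ᶠ X in atTop, 0 < P X ∧ |Real.log (P X) - Real.log τ| ≤ B + r X) :
    0 < c ∧ |Real.log c - Real.log τ| ≤ B := by
  have hr1 : ∀ᶠ X in atTop, r X ≤ 1 := hr.eventually (Iic_mem_nhds one_pos)
  have hlow : ∀ᶠ X in atTop, τ * Real.exp (-(B + 1)) ≤ P X := by
    filter_upwards [hb, hr1] with X hX hrX
    obtain ⟨hP0, habs⟩ := hX
    have h := (abs_le.mp habs).1
    have h' : Real.log τ + -(B + 1) ≤ Real.log (P X) := by linarith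
    calc τ * Real.exp (-(B + 1)) = Real.exp (Real.log τ + -(B + 1)) := by
          rw [Real.exp_add, Real.exp_log hτ]
      _ ≤ Real.exp (Real.log (P X)) := Real.exp_le_exp.mpr h'
      _ = P X := Real.exp_log hP0
  have hc : τ * Real.exp (-(B + 1)) ≤ c := ge_of_tendsto hP hlow
  have hc0 : 0 < c := lt_of_lt_of_le (mul_pos hτ (Real.exp_pos _)) hc
  refine ⟨hc0, ?_⟩
  have hlogP : Tendsto (fun X => Real.log (P X)) atTop (𝓝 (Real.log c)) := hP.log hc0.ne'
  have h1 : Tendsto (fun X => |Real.log (P X) - Real.log τ| - r X) atTop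
      (𝓝 (|Real.log c - Real.log τ| - 0)) :=
    ((hlogP.sub tendsto_const_nhds).abs).sub hr
  rw [sub_zero] at h1
  exact le_of_tendsto h1 (by filter_upwards [hb] with X hX; linarith [hX.2])

/-- If `|log ϱ − log c| ≤ B` with `B ≤ 1` and `2B ≤ ε` (`ϱ, c > 0`), then `|ϱ − c| ≤ ε c`
(`|e^x − 1| ≤ |x| + x² ≤ 2B` for `|x| ≤ B ≤ 1`). [folklore] -/
theorem abs_sub_le_mul_of_abs_log_sub_le {ϱ c B ε : ℝ} (hϱ : 0 < ϱ) (hc : 0 < c) (hB1 : B ≤ 1)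
    (hBε : 2 * B ≤ ε) (h : |Real.log ϱ - Real.log c| ≤ B) : |ϱ - c| ≤ ε * c := by
  set x := Real.log ϱ - Real.log c with hx_def
  have hx : Real.exp x = ϱ / c := by rw [hx_def, Real.exp_sub, Real.exp_log hϱ, Real.exp_log hc]
  have hx1 : |x| ≤ 1 := h.trans hB1
  have hexp : |Real.exp x - 1| ≤ 2 * B := by
    have h1 := Real.abs_exp_sub_one_sub_id_le hx1
    have h2 : x ^ 2 ≤ B := by
      rw [← sq_abs]
      nlinarith [abs_nonneg x]
    calc |Real.exp x - 1| = |(Real.exp x - 1 - x) + x| := by ring_nf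
      _ ≤ |Real.exp x - 1 - x| + |x| := abs_add_le _ _
      _ ≤ B + B := add_le_add (h1.trans h2) h
      _ = 2 * B := by ring
  have hid : ϱ - c = c * (Real.exp x - 1) := by
    rw [hx]; field_simp
  rw [hid, abs_mul, abs_of_pos hc]
  calc c * |Real.exp x - 1| ≤ c * (2 * B) := by gcongr
    _ ≤ c * ε := by gcongr
    _ = ε * c := mul_comm _ _

open Filter _root_.Topology in
/-- The `X`-dependent error terms of `abs_log_batemanHornPartial_sub_log_le` tend to `0`:
`20/log X + A₁/log² X + A₂ X^{−ν}/log X + E₁(κ log X) → 0` (`κ, ν > 0`). [folklore] -/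
theorem tendsto_errX {A₁ A₂ ν κ : ℝ} (hν : 0 < ν) (hκ : 0 < κ) :
    Tendsto (fun X : ℕ => 20 / Real.log X +
      (A₁ / Real.log X ^ 2 + A₂ * (X : ℝ) ^ (-ν) / Real.log X) +
        expIntegralE1 (κ * Real.log X)) atTop (𝓝 0) := by
  have hlog : Tendsto (fun X : ℕ => Real.log (X : ℝ)) atTop atTop :=
    Real.tendsto_log_atTop.comp tendsto_natCast_atTop_atTop
  have hinv : Tendsto (fun X : ℕ => (Real.log (X : ℝ))⁻¹) atTop (𝓝 0) := hlog.inv_tendsto_atTop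
  have h1 : Tendsto (fun X : ℕ => 20 / Real.log X) atTop (𝓝 0) := by
    have := hinv.const_mul 20
    simpa [div_eq_mul_inv] using this
  have h2 : Tendsto (fun X : ℕ => A₁ / Real.log X ^ 2) atTop (𝓝 0) := by
    have := (hinv.pow 2).const_mul A₁
    simpa [div_eq_mul_inv] using this
  have h3 : Tendsto (fun X : ℕ => A₂ * (X : ℝ) ^ (-ν) / Real.log X) atTop (𝓝 0) := by
    have hr : Tendsto (fun X : ℕ => (X : ℝ) ^ (-ν)) atTop (𝓝 0) :=
      (tendsto_rpow_neg_atTop hν).comp tendsto_natCast_atTop_atTop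
    have := (hr.const_mul A₂).mul hinv
    simpa [div_eq_mul_inv] using this
  have h4 : Tendsto (fun X : ℕ => expIntegralE1 (κ * Real.log X)) atTop (𝓝 0) :=
    Literature.NumberTheory.Sieve.tendsto_expIntegralE1_atTop.comp (hlog.const_mul_atTop hκ)
  simpa using ((h1.add (h2.add h3)).add h4)


open Filter _root_.Topology in
/-- **The limit form of §8** (`q ≡ 3 (mod 8)`): under the explicit-formula bound for `θ(t; (·/q))`
on `[U, ∞)`, `U = q^{η/M}`, if the Bateman–Horn partial products of `f_d` converge to `c` then
`c > 0` and `|log c − log(ϱ_d η log q)| ≤ 16/(⌊√q⌋+1) + ∑_{√q < p ≤ U} ω(p)/p + 8/log U + R_∞ + 1/M`.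
[cite: GranvilleMollin2000, §8] -/
theorem pos_and_abs_log_sub_log_gmRho_le {d : ℤ} {q : ℕ} (hdq : d = -(q : ℤ)) (hq8 : q % 8 = 3)
    (hq16 : 16 ≤ q) {η M ν A₁ A₂ U : ℝ} (hM : 0 < M) (hη : 0 < η)
    (hηq : 1 < η * Real.log q) (hU : U = (q : ℝ) ^ (η / M)) (hUe : Real.exp 1 ≤ U)
    (hsqU : Real.sqrt q ≤ U) (hν : 0 < ν) (hA₁ : 0 ≤ A₁) (hA₂ : 0 ≤ A₂)
    (hθ : ∀ t : ℝ, U ≤ t →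
      |jacobiTheta q t + t ^ (1 - 1 / (η * Real.log q)) / (1 - 1 / (η * Real.log q))| ≤
        A₁ * t / Real.log t + A₂ * t ^ (1 - ν))
    {c : ℝ} (hc : Literature.NumberTheory.Sieve.HasBatemanHornConst ![rabinowitschPoly d] c) :
    0 < c ∧ |Real.log c - Real.log (gmRho d * (η * Real.log q))| ≤
      16 / ((⌊Real.sqrt q⌋₊ : ℝ) + 1) +
        ∑ p ∈ (Nat.primesLE ⌊U⌋₊).filter (fun p => ⌊Real.sqrt q⌋₊ < p),
          (polyRootCountMod ![rabinowitschPoly d] p : ℝ) / p +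
        8 / Real.log U +
        (A₁ / Real.log U ^ 2 + A₂ * U ^ (-ν) / Real.log U +
          (2 * A₁ / Real.log U + 2 * A₂ * U ^ (-ν) / (ν * Real.log U))) + 1 / M := by
  have hq1 : (1 : ℝ) < q := by exact_mod_cast (show 1 < q by omega)
  have hlogq : 0 < Real.log q := Real.log_pos hq1
  have hϱ : 0 < gmRho d := gmRho_pos hdq hq8
  have hτ : 0 < gmRho d * (η * Real.log q) := mul_pos hϱ (mul_pos hη hlogq)
  have hκ : 0 < 1 / (η * Real.log q) := by positivity
  refine pos_and_abs_log_sub_le_of_tendsto hτ hc (tendsto_errX (A₁ := A₁) (A₂ := A₂) hν hκ) ?_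
  filter_upwards [eventually_ge_atTop ⌈U⌉₊] with X hX
  have hUX : U ≤ (X : ℝ) := (Nat.le_ceil U).trans (by exact_mod_cast hX)
  refine ⟨batemanHornPartial_rabinowitsch_pos hdq hq8 X, ?_⟩
  have h := abs_log_batemanHornPartial_sub_log_le hdq hq8 hq16 hM hη hηq hU hUe hsqU hUX hν hA₁ hA₂
    (fun t ht => hθ t ht.1)
  linarith [h]

end Literature.Barriers.Parity
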